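import Summits.CriticalPhenomena.SAWScalingLimit.Theses.SAWDimerizationRG
import Literature.Probability.RandomPlanarGeometry.SAWScalingLimitFamily
import HarnessLib.Audit

/-!
# Crux `CanonicalToChordal` (stmt-CriticalPhenomena-5724) — birth skeleton `Lines/birth.lean`

Route `SAWDimerizationRG` (sub-problem `SAWScalingLimit`).  Crux, BY NAME:
`Summit.CriticalPhenomena.SAWScalingLimit.Theses.SAWDimerizationRG.CanonicalToChordal`
= `CanonicalLimit → SAWScalingLimit`: the existence of the canonical whole-plane limit `P*` (the uniform
`n`-step SAW of `ℤ²` from `0`, rescaled by `r_n`, converges in law on `CurveClass ℂ` to a non-degenerate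
law) implies the chordal conjunct (the critical `x_c`-weighted SAW of every Dobrushin domain converges to
chordal SLE_{8/3}).  The route's informal engine: (R) FUSION RIGIDITY identifies `P*` (two-sided
whole-plane SLE_{8/3} in its natural parametrisation, up to the finite-window tilt), and (D) CONDITION
AND MIX — the critical chordal law in `(Ω_δ; a_δ, b_δ)` is EXACTLY the `x_c^n·c_n`-mixture over `n` of the
uniform `n`-step law from `a_δ` conditioned on `{ω ⊂ Ω̄_δ, ω_n = b_δ}` ("uniform conditions to uniform"),
whose limit is read off from `P*`.

## The line (typed over the tree's chordal-family vocabulary, `SAWScalingLimitFamily.lean`)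

The chordal conjunct factors EXACTLY through a scaling-limit family: `SAWScalingLimit` follows from
`∃ P, SAW.IsScalingLimitFamily P ∧ ∀ D, IsSLELaw (8/3) D (P D)` by the PROVED library theorem
`SAW.IsScalingLimitFamily.sawScalingLimit` (move the test integrals along `integral_map`; measurability
of `γ ↦ γ.curve` is automatic), and conversely under uniqueness in law of chordal SLE
(`SAW.sawScalingLimit_iff_of_chordal_sle`).  Along this seam the crux `CanonicalLimit → SAWScalingLimit`
is the composition of the two steps the route itself names ((D) existence of the conditioned mixture's
limit, (R) ⇒ its identification), each UNDER the crux's own hypothesis `CanonicalLimit`: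

* `stub_conditionAndMix` — (D), EXISTENCE HALF: under `CanonicalLimit`, the critical chordal SAW laws of
  EVERY Dobrushin domain and EVERY endpoint approximation converge jointly to a chordal curve family,
  `∃ P, SAW.IsScalingLimitFamily P` (the conclusion is verbatim `SAWRestrictionRigidity.LimitExists`,
  stmt-CriticalPhenomena-1371, by `Iff.rfl`; here it is asked only GIVEN the canonical whole-plane limit:
  the chordal law is the `x_c^n`-mixture of pinned canonical laws, so what is needed is (i) the exact
  dictionary, (ii) convergence of the canonical laws CONDITIONED on the polynomially rare pinned events
  `{ω ⊂ Ω̄_δ, ω_n = b_δ}` (boundary pinning exponent `25/64` per end, Kennedy–Lawler 2013 §2) and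
  (iii) summability of the mixture weights (tail of the natural-length law)).  OPEN; strictly weaker than
  `LimitExists` (implied by it with the hypothesis ignored) and not comparable with the crux.
* `stub_identifyMixture` — (R) ⇒ IDENTIFICATION: under `CanonicalLimit`, every chordal scaling-limit
  family of the critical SAW consists of chordal SLE_{8/3} laws.  This is where fusion rigidity F*
  (informal item stmt-CriticalPhenomena-6821) is load-bearing: `P*` identified with (a tilt of) two-sided
  whole-plane SLE_{8/3}, the conditioned mixture in `(Ω; a, b)` with natural length integrated out is
  chordal SLE_{8/3} (domain Markov + restriction of the identified whole-plane object).  OPEN; a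
  CONSEQUENCE of the conjunct given uniqueness in law of chordal SLE and one chordal SLE_{8/3} family
  (`SAW.IsScalingLimitFamily.isSLELaw_of_sawScalingLimit`), hence exactly as safe as the crux, and it
  does not give the conjunct without the existence half.

`CanonicalToChordal_of (h₁ : Registered.stub_conditionAndMix) (h₂ : Registered.stub_identifyMixture) :
CanonicalToChordal` is PROVED below (no sorry): introduce the canonical limit `hE`, take the family `P`
of `h₁ hE`, and apply `SAW.IsScalingLimitFamily.sawScalingLimit` with the identification `h₂ hE P hP`.
(The `Registered.stub_*` abbrevs are the stub statements keyed by stub name — the skeleton-check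
convention: the hypotheses of `CanonicalToChordal_of` are exactly the declared stubs, each BY NAME; the
`example` at the end wires the sorried stub theorems through it as a definitional consistency check.)

Sorries: exactly 2 = `stub_conditionAndMix`, `stub_identifyMixture`; zero elsewhere.  Disproof used: none
(no `Disproof.lean` on stmt-5724 yet; `ledger crux ls` shows no workfiles, no crux ideas).  Negatives
honoured (`ledger negatives --problem CriticalPhenomena`, 11 entries): the only SAW-limit negative,
stmt-0772 (all-`δ` tightness `Tight`, `SAWParafermionTight_refuted`), is not used — no tightness
statement appears; existence is asked as a full `TendstoLaw` family, eventual in `δ` by construction of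
`𝓝[>] 0`.  BC3 probes (planner folder `bc/probe_{D,R}_{crux,summit}.lean`): for each stub,
`stub → CanonicalToChordal` and `stub → SAWScalingLimit` by `first | exact? | simpa [stub] | (unfold stub;
simpa) | aesop` (and the variant with the crux / conjunct unfolded one step) FAIL.
-/

noncomputable section

open MeasureTheory Filter Topology Set Function
open Literature.Probability.RandomPlanarGeometry Literature.Probability.RandomPlanarGeometry.SAW
open Literature.Probability.LatticeModels
open scoped ENNReal NNReal BoundedContinuousFunction MeasureTheory Topology ProbabilityTheory

namespace Summit.CriticalPhenomena.SAWScalingLimit.Cruxes.CanonicalToChordal.Birth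

/-! ## The registered stubs -/

/-- **stub (D) — CONDITION AND MIX, existence half.**  Under the canonical whole-plane limit
(`CanonicalLimit`: some deterministic `r_n > 0` and a non-degenerate probability law `P*` on
`CurveClass ℂ` with `U_n` at mesh `1/r_n` `→ P*` in law), the critical chordal SAW laws
`SAW.law D.carrier δ (a δ) (b δ)` — each EXACTLY the `x_c^n·c_n`-weighted mixture over `n` of the uniform
`n`-step law from `a δ` conditioned on `{ω ⊂ Ω̄_δ, ω_n = b δ}` — pushed to curves, converge weakly as
`δ → 0⁺`, for EVERY Dobrushin domain `D` and EVERY endpoint approximation, to the laws `P D` of ONE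
chordal curve family `P` (`SAW.IsScalingLimitFamily P`: `P.IsChordal ∧ ∀ D a b, IsEndpointApprox D a b →
TendstoLaw (curve) (SAW.law …) id (P D)`).  OPEN.  Why it might fail: conditioning `U_n` on the pinned
event costs `N^(-25/64)·l(θ)` per end and lattice effects persist for boundary ensembles
(Kennedy–Lawler 2013 §2, §4); continuity of the canonical limit under this singular conditioning and the
tail of the natural-length law in the mixture are both uncontrolled.
Sources: KennedyLawler2013 (arXiv:1109.3091) §2, §4; LawlerSchrammWerner2004SAW (arXiv:math/0204277)
§3.4.2, §4.3; MadrasSlade1993 Lemma 9.3.1; LawlerSheffield2011. -/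
theorem stub_conditionAndMix : Summit.CriticalPhenomena.SAWScalingLimit.Theses.SAWDimerizationRG.CanonicalLimit → ∃ P : Literature.Probability.RandomPlanarGeometry.ChordalFamily, Literature.Probability.RandomPlanarGeometry.SAW.IsScalingLimitFamily P := by
  sorry

/-- **stub (R ⇒ D) — IDENTIFICATION OF THE MIXTURE.**  Under the canonical whole-plane limit, every
chordal scaling-limit family `P` of the critical square-lattice SAW consists of chordal SLE_{8/3} laws:
`IsSLELaw (8/3) D (P D)` for every Dobrushin domain `D`.  Intended proof (the route's (R) + the reading
half of (D)): fusion rigidity F* identifies `P*` with (the finite-window tilt of) two-sided whole-plane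
SLE_{8/3} in its natural parametrisation; the limit of the conditioned `x_c^n`-mixture in `(Ω; a, b)` is
then the corresponding pinned/conditioned SLE_{8/3} object with its natural length integrated out, i.e.
chordal SLE_{8/3} from `a` to `b` in `Ω`.  OPEN.  Why it might fail: F* itself (uniqueness of the fusion
fixed point in the D4-symmetric, re-rooting-stationary, dilation-covariant class) is untested and the
upgrade from Euclidean + scale data to conformal invariance is exactly what the barriers
`EmbeddingModulusUniqueness` / `ScaleCovarianceNotMoebius` exclude without extra input; the passage
"identified whole-plane law ⇒ identified conditioned domain law" needs a domain-Markov/restriction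
calculus for the natural-length-parametrised object (Lawler–Sheffield, Lawler–Rezaei).
Sources: LawlerSchrammWerner2004SAW §3.4.6, §4.1 Prediction 1, §4.3 Predictions 7–8; LawlerLind2007;
KozdronLawler2007; LawlerRezaei2015; Zhan2021SLELoopMeasures Cor. 4.7;
Literature.Barriers.CriticalPhenomena.EmbeddingModulusUniqueness. -/
theorem stub_identifyMixture : Summit.CriticalPhenomena.SAWScalingLimit.Theses.SAWDimerizationRG.CanonicalLimit → ∀ P : Literature.Probability.RandomPlanarGeometry.ChordalFamily, Literature.Probability.RandomPlanarGeometry.SAW.IsScalingLimitFamily P → ∀ D : Literature.Probability.RandomPlanarGeometry.DobrushinDomain, Literature.Probability.RandomPlanarGeometry.IsSLELaw ((8 : NNReal) / 3) D (P D) := by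
  sorry

/-! ## Name-keyed aliases of the stub statements (skeleton-check convention: the hypotheses of
`CanonicalToChordal_of` are exactly the declared stubs, each BY NAME) -/

namespace Registered

/-- Alias keyed by the stub name: the statement of `stub_conditionAndMix`. -/
abbrev stub_conditionAndMix : Prop :=
  Summit.CriticalPhenomena.SAWScalingLimit.Theses.SAWDimerizationRG.CanonicalLimit → ∃ P : Literature.Probability.RandomPlanarGeometry.ChordalFamily, Literature.Probability.RandomPlanarGeometry.SAW.IsScalingLimitFamily P

/-- Alias keyed by the stub name: the statement of `stub_identifyMixture`. -/
abbrev stub_identifyMixture : Prop :=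
  Summit.CriticalPhenomena.SAWScalingLimit.Theses.SAWDimerizationRG.CanonicalLimit → ∀ P : Literature.Probability.RandomPlanarGeometry.ChordalFamily, Literature.Probability.RandomPlanarGeometry.SAW.IsScalingLimitFamily P → ∀ D : Literature.Probability.RandomPlanarGeometry.DobrushinDomain, Literature.Probability.RandomPlanarGeometry.IsSLELaw ((8 : NNReal) / 3) D (P D)

end Registered

/-! ## The composition: the crux BY NAME from the two stubs -/

/-- **`CanonicalToChordal` from (D) and (R ⇒ D).**  Given the canonical whole-plane limit `hE`, the
existence half (D) yields a chordal scaling-limit family `P` of the critical SAW; the identification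
(R ⇒ D) makes every `P D` the chordal SLE_{8/3} law in `D`; the library's
`SAW.IsScalingLimitFamily.sawScalingLimit` (write `P D = W.map Γ` for an SLE_{8/3} curve `Γ` and move the
test integrals along `integral_map`) gives `ConvergesInLawToSLE (8/3) D` for every endpoint
approximation, i.e. the conjunct. [cite: LawlerSchrammWerner2004SAW, §4.1 Prediction 1] -/
theorem CanonicalToChordal_of (h₁ : Registered.stub_conditionAndMix)
    (h₂ : Registered.stub_identifyMixture) :
    Summit.CriticalPhenomena.SAWScalingLimit.Theses.SAWDimerizationRG.CanonicalToChordal := by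
  -- the crux is the implication `CanonicalLimit → SAWScalingLimit`
  intro hE
  -- (D) existence: a chordal scaling-limit family of the critical SAW
  obtain ⟨P, hP⟩ := h₁ hE
  -- (R ⇒ D) identification of its laws, then the library reformulation of the conjunct
  exact hP.sawScalingLimit (h₂ hE P hP)

/-- Wiring / consistency check (an `example`, so no named declaration and no extra `sorry` warning): the
sorried stub THEOREMS are exactly the hypotheses of `CanonicalToChordal_of` (the `Registered.stub_*`
abbrevs unfold to their statements definitionally). -/
example : Summit.CriticalPhenomena.SAWScalingLimit.Theses.SAWDimerizationRG.CanonicalToChordal :=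
  CanonicalToChordal_of stub_conditionAndMix stub_identifyMixture

/-! ## Pins (documentation, proved): how the two stubs sit relative to the conjunct -/

/-- The seam is exact: existence of a scaling-limit family of SLE_{8/3} laws IS a reformulation of the
conjunct's sufficient half (library: `SAW.IsScalingLimitFamily.sawScalingLimit`). -/
theorem sawScalingLimit_of_exists_family
    (h : ∃ P : ChordalFamily, SAW.IsScalingLimitFamily P ∧ ∀ D : DobrushinDomain,
      IsSLELaw ((8 : ℝ≥0) / 3) D (P D)) : _root_.SAWScalingLimit := by
  obtain ⟨P, hP, hsle⟩ := h
  exact hP.sawScalingLimit hsle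

/-- Necessity of (R ⇒ D) (sanity): under the conjunct, uniqueness in law of chordal SLE
(`IsSLECurve.map_eq`, PROVED in tree as `IsSLECurve.map_eq_holds`, not imported here to keep the
skeleton's cone small — taken as a hypothesis) and one chordal family of SLE_{8/3} laws, every scaling-limit
family consists of SLE_{8/3} laws; so `stub_identifyMixture` is a CONSEQUENCE of `SAWScalingLimit` and
cannot be refuted unless the conjunct is. -/
theorem identifyMixture_of_sawScalingLimit (huniq : IsSLECurve.map_eq) {Q : ChordalFamily}
    (hQ : Q.IsChordal) (hQsle : ∀ D : DobrushinDomain, IsSLELaw ((8 : ℝ≥0) / 3) D (Q D))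
    (h : _root_.SAWScalingLimit) : Registered.stub_identifyMixture :=
  fun _ _ hP D => hP.isSLELaw_of_sawScalingLimit huniq h hQ hQsle D

end Summit.CriticalPhenomena.SAWScalingLimit.Cruxes.CanonicalToChordal.Birth

end
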